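import Summits.KontsevichZagierPeriods.KontsevichZagierPeriods.Theorems.HurwitzMicroSectorsNormalFormPrincipleL2W3Carriers
import Summits.KontsevichZagierPeriods.KontsevichZagierPeriods.Theorems.HurwitzMicroSectorsNormalFormPrincipleL2W3ExistsChartTargets
import Summits.KontsevichZagierPeriods.KontsevichZagierPeriods.Theorems.HurwitzMicroSectorsNormalFormPrincipleM3EbdBoxSubSimplex
import Summits.KontsevichZagierPeriods.KontsevichZagierPeriods.Theorems.HurwitzMicroSectorsNormalFormPrincipleL2W3RelationsDilation
import Summits.KontsevichZagierPeriods.KontsevichZagierPeriods.Theorems.HurwitzMicroSectorsNormalFormPrincipleL2W3RelationsMoebiusOne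
import Summits.KontsevichZagierPeriods.KontsevichZagierPeriods.Theorems.HurwitzMicroSectorsNormalFormPrincipleL2W3RelationsMoebiusTwo
import Summits.KontsevichZagierPeriods.KontsevichZagierPeriods.Theorems.HurwitzMicroSectorsNormalFormPrincipleL2W3RelationsMoebiusThree
import Summits.KontsevichZagierPeriods.KontsevichZagierPeriods.Theorems.HurwitzMicroSectorsNormalFormPrincipleL2W3RelationsReflection

/-!
# `NormalFormPrinciple` (stmt-KontsevichZagierPeriods-3869), line `SketchIdeator1` —
# leaf `stub_boxRigidity` in DIMENSION THREE: HalfPointZetaThree `[(0,1)³, 16/((2−x)(2−xyz))] ∼ [(0,1)³, 5/(1−xyz)]`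

Assembly file (layer `L2W3`, lead seat c9; `--supports` the crux) of a target of the crux idea
`m3-equal-value-instances` (strategist gen 2): `16∫dV/((2−x)(2−xyz)) = 5ζ(3)` — polylogarithms at `1/2`
(`Li₃(1/2)`, `π²log 2`, `log³2`) with every `log 2` term cancelling. Inside the calculus the half-point
alphabet `{dt/t, dt/(1−t), dt/(2−t)}` is the REFLECTION `t ↦ 1 − t` of the alternating alphabet
`{dt/(1−t), dt/t, dt/(1+t)}`, so the instance reduces to the level-2 weight-3 descent of
`…L2W3FiveEighthsZetaThree.lean` plus one more Möbius relation (`rel6`: `∫acc = ∫ccb + ∫ccc`). Chain: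
simplex chart (`8[aad] + 8[dad]` vs `5[aab]`), two reflections (`[aad] = [cbb]`, `[dad] = [cbc]`), and
`8[cbb] + 8[cbc] − 5[aab] = −rel1 − 2rel2 + 4rel3 − 4rel4 + 6rel5 − 8rel6`. No independence input.
Sources: M. Kontsevich, D. Zagier, *Periods* (2001), §1.2; L. Lewin, *Polylogarithms and associated
functions* (1981), §6.3 (`Li₃(1/2)`). No definitions are introduced.
-/

noncomputable section

open MeasureTheory Set
open Literature.NumberTheory.Transcendental Literature.NumberTheory.Transcendental.KZ
open Literature.ModelTheory.ExponentialFields (IsSemialgebraic)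
open Summit.KontsevichZagierPeriods.HyperbolicBloch.OffTetraSectorKernel
  (aff_orbit_of_sub_sum_zsmul_mem_relations)

namespace Summit.KontsevichZagierPeriods.HurwitzMicroSectors.NormalFormPrinciple.PiBox.M3

/-- **HalfPointZetaThree (`StrategistGen2.HalfPointZetaThree`, crux idea `m3-equal-value-instances`;
registered sub-goal of stmt-KontsevichZagierPeriods-3869, line `SketchIdeator1`, layer `L2W3`).** Any
representation of `[(0,1)³, 16/((2−x)(2−xyz))]` is KZ-equivalent to any representation of
`[(0,1)³, 5/(1−xyz)]` (`16∫dV/((2−x)(2−xyz)) = 5ζ(3)`: trilogarithms at `1/2` with every `log 2`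
cancelling): the box charts give `8[aad] + 8[dad]` and `5[aab]`; two reflection moves convert the
half-point words to alternating ones (`[aad] = [cbb]`, `[dad] = [cbc]`), and then
`8[cbb] + 8[cbc] − 5[aab] = −rel1 − 2rel2 + 4rel3 − 4rel4 + 6rel5 − 8rel6` (dilation, Möbius,
duality moves). [cite: KontsevichZagier2001, §1.2 rules (1), (2)] -/
theorem halfPointZetaThree (r r' : IntegralRep 3)
    (hrd : r.domain = {x | ∀ i, x i ∈ Set.Ioo (0:ℝ) 1})
    (hri : EqOn r.integrand (fun x => 16 / ((2 - x 0) * (2 - x 0 * x 1 * x 2))) {x | ∀ i, x i ∈ Set.Ioo (0:ℝ) 1})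
    (hr'd : r'.domain = {x | ∀ i, x i ∈ Set.Ioo (0:ℝ) 1})
    (hr'i : EqOn r'.integrand (fun x => 5 / (1 - x 0 * x 1 * x 2)) {x | ∀ i, x i ∈ Set.Ioo (0:ℝ) 1}) :
    Equivalent r r' := by
  obtain ⟨AAB, ABB, AAC, ACC, ABC, ACB, CBB, CBC, CCB, CCC, CAB, CAC, AAD, DAD, ADD, DAB,
    ⟨hAABd, hAABi⟩, ⟨hABBd, hABBi⟩, ⟨hAACd, hAACi⟩, ⟨hACCd, hACCi⟩, ⟨hABCd, hABCi⟩, ⟨hACBd, hACBi⟩,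
    ⟨hCBBd, hCBBi⟩, ⟨hCBCd, hCBCi⟩, ⟨hCCBd, hCCBi⟩, ⟨hCCCd, hCCCi⟩, ⟨hCABd, hCABi⟩, ⟨hCACd, hCACi⟩,
    ⟨hAADd, hAADi⟩, ⟨hDADd, hDADi⟩, ⟨hADDd, hADDi⟩, ⟨hDABd, hDABi⟩⟩ := l2w3_carriers
  obtain ⟨⟨G1, hG1d, hG1i⟩, ⟨G2, hG2d, hG2i⟩, ⟨G3, hG3d, hG3i⟩, ⟨G4, hG4d, hG4i⟩, ⟨G5, hG5d, hG5i⟩,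
    ⟨G6, hG6d, hG6i⟩⟩ := l2w3_exists_chartTargets
  have e0 : of r - of G3 ∈ relations := by
    refine ebd_box_sub_simplex (fun t => 16 / (t 0 * (2 - t 0) * t 1 * (2 - t 2))) r G3 hrd hG3d
      (hG3i ▸ fun _ _ => rfl) fun x hx => ?_
    have hx' : ∀ i, x i ∈ Set.Ioo (0:ℝ) 1 := by rw [hrd] at hx; exact hx
    have h0 : x 0 ≠ 0 := (hx' 0).1.ne'
    have h1 : x 1 ≠ 0 := (hx' 1).1.ne'
    have h2x : 2 - x 0 ≠ 0 := by linarith [(hx' 0).2]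
    have h2p : 2 - x 0 * x 1 * x 2 ≠ 0 := by
      have := mul_lt_one_of_nonneg_of_lt_one_left (mul_pos (hx' 0).1 (hx' 1).1).le
        (mul_lt_one_of_nonneg_of_lt_one_left (hx' 0).1.le (hx' 0).2 (hx' 1).2.le) (hx' 2).2.le
      linarith
    rw [hri hx']
    simp only [Matrix.cons_val_zero, Matrix.cons_val_one, Matrix.cons_val_two, Matrix.head_cons,
      Matrix.tail_cons]
    field_simp
  have e0' : of G3 - ((8:ℤ) • of AAD + (8:ℤ) • of DAD) ∈ relations := by
    have h := aff_orbit_of_sub_sum_zsmul_mem_relations (Finset.univ : Finset (Fin 2))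
      ![AAD, DAD] ![8, 8] G3 (fun i _ => by
        fin_cases i
        · exact hAADd.trans hG3d.symm
        · exact hDADd.trans hG3d.symm) fun t ht => ?_
    · simpa [Fin.sum_univ_two, add_assoc] using h
    have hf := l2v_simplex_facts (hG3d ▸ ht)
    simp only [Fin.sum_univ_two, Matrix.cons_val_zero, Matrix.cons_val_one, hG3i, hAADi, hDADi]
    have h0 : t 0 ≠ 0 := hf.1.ne'
    have h0a : 1 - t 0 ≠ 0 := by linarith [hf.2.1]
    have h0b : 1 + t 0 ≠ 0 := by linarith [hf.1]
    have h0c : 2 - t 0 ≠ 0 := by linarith [hf.2.1]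
    have h1 : t 1 ≠ 0 := hf.2.2.1.ne'
    have h1a : 1 - t 1 ≠ 0 := by linarith [hf.2.2.2.1]
    have h1b : 1 + t 1 ≠ 0 := by linarith [hf.2.2.1]
    have h1c : 2 - t 1 ≠ 0 := by linarith [hf.2.2.2.1]
    have h2a : 1 - t 2 ≠ 0 := by linarith [hf.2.2.2.2.2]
    have h2b : 1 + t 2 ≠ 0 := by linarith [hf.2.2.2.2.1]
    have h2c : 2 - t 2 ≠ 0 := by linarith [hf.2.2.2.2.2]
    push_cast
    field_simp
    ring
  have e1 : of r' - of G2 ∈ relations := by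
    refine ebd_box_sub_simplex (fun t => 5 / (t 0 * t 1 * (1 - t 2))) r' G2 hr'd hG2d
      (hG2i ▸ fun _ _ => rfl) fun x hx => ?_
    have hx' : ∀ i, x i ∈ Set.Ioo (0:ℝ) 1 := by rw [hr'd] at hx; exact hx
    have h0 : x 0 ≠ 0 := (hx' 0).1.ne'
    have h1 : x 1 ≠ 0 := (hx' 1).1.ne'
    have h012m : 1 - x 0 * x 1 * x 2 ≠ 0 := by
      have := mul_lt_one_of_nonneg_of_lt_one_left (mul_pos (hx' 0).1 (hx' 1).1).le
        (mul_lt_one_of_nonneg_of_lt_one_left (hx' 0).1.le (hx' 0).2 (hx' 1).2.le) (hx' 2).2.le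
      exact (sub_pos.2 this).ne'
    rw [hr'i hx']
    simp only [Matrix.cons_val_zero, Matrix.cons_val_one, Matrix.cons_val_two, Matrix.head_cons,
      Matrix.tail_cons]
    field_simp
  have e1' : of G2 - ((5:ℤ) • of AAB) ∈ relations := by
    have h := aff_orbit_of_sub_sum_zsmul_mem_relations (Finset.univ : Finset (Fin 1))
      ![AAB] ![5] G2 (fun i _ => by fin_cases i; exact hAABd.trans hG2d.symm) fun t ht => ?_
    · simpa using h
    have hf := l2v_simplex_facts (hG2d ▸ ht)
    simp only [Finset.univ_unique, Fin.default_eq_zero, Finset.sum_singleton, Matrix.cons_val_zero,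
      hG2i, hAABi]
    have h0 : t 0 ≠ 0 := hf.1.ne'
    have h0a : 1 - t 0 ≠ 0 := by linarith [hf.2.1]
    have h0b : 1 + t 0 ≠ 0 := by linarith [hf.1]
    have h0c : 2 - t 0 ≠ 0 := by linarith [hf.2.1]
    have h1 : t 1 ≠ 0 := hf.2.2.1.ne'
    have h1a : 1 - t 1 ≠ 0 := by linarith [hf.2.2.2.1]
    have h1b : 1 + t 1 ≠ 0 := by linarith [hf.2.2.1]
    have h1c : 2 - t 1 ≠ 0 := by linarith [hf.2.2.2.1]
    have h2a : 1 - t 2 ≠ 0 := by linarith [hf.2.2.2.2.2]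
    have h2b : 1 + t 2 ≠ 0 := by linarith [hf.2.2.2.2.1]
    have h2c : 2 - t 2 ≠ 0 := by linarith [hf.2.2.2.2.2]
    push_cast
    field_simp
  have rel1 : (3:ℤ) • of AAB - (4:ℤ) • of AAC ∈ relations :=
    l2w3_relations_dilation.1 AAB hAABd hAABi AAC hAACd hAACi
  have rel2 : of ABB - (2:ℤ) • of ABC - (2:ℤ) • of ACB + (2:ℤ) • of ACC ∈ relations :=
    l2w3_relations_dilation.2 ABB hABBd hABBi ABC hABCd hABCi ACB hACBd hACBi ACC hACCd hACCi
  have rel3 : of CBB + of CBC + of CCB + of CCC - of AAC ∈ relations :=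
    l2w3_relations_moebius_one.1 AAC hAACd hAACi CBB hCBBd hCBBi CBC hCBCd hCBCi CCB hCCBd hCCBi CCC hCCCd hCCCi
  have rel4 : of ABB + of ABC + of ACB + of ACC - of CBB - of CBC - of CCB - of CCC - of AAB ∈ relations :=
    l2w3_relations_moebius_one.2 AAB hAABd hAABi ABB hABBd hABBi ABC hABCd hABCi ACB hACBd hACBi ACC hACCd hACCi
      CBB hCBBd hCBBi CBC hCBCd hCBCi CCB hCCBd hCCBi CCC hCCCd hCCCi
  have rel5 : of ABB - of AAB ∈ relations := l2w3_relations_reflection.1 AAB hAABd hAABi ABB hABBd hABBi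
  have rel6 : of CCB + of CCC - of ACC ∈ relations :=
    l2w3_relations_moebius_two.1 ACC hACCd hACCi CCB hCCBd hCCBi CCC hCCCd hCCCi
  have conv1 : of AAD - of CBB ∈ relations := l2w3_relations_reflection.2.1 CBB hCBBd hCBBi AAD hAADd hAADi
  have conv2 : of DAD - of CBC ∈ relations := l2w3_relations_reflection.2.2.1 CBC hCBCd hCBCi DAD hDADd hDADi
  have key : ((8:ℤ) • of AAD + (8:ℤ) • of DAD) - (5:ℤ) • of AAB =
      (8:ℤ) • (of AAD - of CBB) + (8:ℤ) • (of DAD - of CBC)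
      + (-((3:ℤ) • of AAB - (4:ℤ) • of AAC)
      - (2:ℤ) • (of ABB - (2:ℤ) • of ABC - (2:ℤ) • of ACB + (2:ℤ) • of ACC)
      + (4:ℤ) • (of CBB + of CBC + of CCB + of CCC - of AAC)
      - (4:ℤ) • (of ABB + of ABC + of ACB + of ACC - of CBB - of CBC - of CCB - of CCC - of AAB)
      + (6:ℤ) • (of ABB - of AAB)
      - (8:ℤ) • (of CCB + of CCC - of ACC)) := by
    simp only [smul_sub, smul_add, smul_smul]
    norm_num
    abel
  have hmid : ((8:ℤ) • of AAD + (8:ℤ) • of DAD) - (5:ℤ) • of AAB ∈ relations := by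
    rw [key]
    refine relations.add_mem (relations.add_mem (relations.zsmul_mem conv1 8) (relations.zsmul_mem conv2 8)) ?_
    exact relations.sub_mem (relations.add_mem (relations.sub_mem (relations.add_mem (relations.sub_mem
      (relations.neg_mem rel1) (relations.zsmul_mem rel2 2)) (relations.zsmul_mem rel3 4))
      (relations.zsmul_mem rel4 4)) (relations.zsmul_mem rel5 6)) (relations.zsmul_mem rel6 8)
  have e : of r - of r' = (of r - of G3) + (of G3 - ((8:ℤ) • of AAD + (8:ℤ) • of DAD))
      + (((8:ℤ) • of AAD + (8:ℤ) • of DAD) - (5:ℤ) • of AAB) - (of G2 - (5:ℤ) • of AAB)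
      - (of r' - of G2) := by abel
  show of r - of r' ∈ relations
  rw [e]
  exact relations.sub_mem (relations.sub_mem (relations.add_mem (relations.add_mem e0 e0') hmid) e1') e1

end Summit.KontsevichZagierPeriods.HurwitzMicroSectors.NormalFormPrinciple.PiBox.M3
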